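import Summits.ResolutionOfSingularities.ResolutionOfSingularities.Theorems.WildConesCampaignW46HypersurfacesCharTwoEmbDimDefs
import Summits.ResolutionOfSingularities.ResolutionOfSingularities.Theorems.WildConesCampaignW46HypersurfacesCharTwoCubicFormDefs
import Summits.ResolutionOfSingularities.ResolutionOfSingularities.Theorems.WildConesCampaignW46HypersurfacesCharTwoHilbertDefs
import Mathlib.Algebra.CharP.Defs
import Mathlib.FieldTheory.Perfect
import Mathlib.FieldTheory.IsAlgClosed.Basic
import Mathlib.Data.Matrix.Mul

/-!
# [OURS · L1 W4.6, rung (ii)] STATEMENTS of the corank-two CENSUS package — `h₂ = 1 + dim N` (null polars of the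
# kernel cubic), cubic polarization, the UNCONDITIONAL count of infinitely-near `p`-fold points at `h₂ ≤ 2`, and the
# FREE-point count — for hypersurface `p`-fold points `z^p = a(u₁,…,uₙ)` IN EVERY DIMENSION `n` (instance `p = 2`
# proved for all `n`) over route WildCones' point-blow-up dynamics — campaign s46 of cell res-hironaka
# (LADDER-RESOLUTION rung L, D-0089); host route WildCones, `--kind definition --supports stmt-ResolutionOfSingularities-16884`

HONEST FRAMING. Everything below is OURS (campaign statements of slot W4.6, typed by the prover res-L1-s46-pv-4
(gen 6) in the pattern of `Theorems/WildConesCampaignW46HypersurfacesCharTwoNearLocusStatement.lean` (p540412, rev 5,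
23 predicates; that file is past the 400-line cap, hence this new file): predicates `def … (p n : ℕ) : Prop` in the
characteristic AND THE DIMENSION, one decl per statement, no theorem, no `sorry`) over route WildCones' typed
point-blow-up dynamics (`Theorems/WildConesClassicalRegimesDefs.lean`: states `c : (Fin n → ℕ) → κ` = coefficients of
`a(u₁,…,uₙ)` in `z^p = a`, `ser` the cleaned series, `step i τ c` = blow up the point, chart `u_i`, translate by `τ`,
delete `p`-th powers; `MultP` = cleaned order `≥ p`, `Isol` = finite Milnor algebra `κ⟦u⟧/(∂a)`, `mu` = its
dimension), the seat's invariants `CampaignW46.milnorEmbDim p n κ c = e(c)` (p498937; at `p = 2` the corank of the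
POLAR MATRIX `P = ([u_s u_t] a)_{s ≠ t}`, spelled out inline as in p540412), `CampaignW46.milnorHilbertTwo p n κ c = h₂(c)`
(p511581, `dim 𝔪_A²/𝔪_A³` of the Milnor algebra) and `CampaignW46.degForm` (p522667: `degForm 3 (ser c) w = a₃(w)`, the
TANGENT CUBIC; `degForm 2 (∂ₛ ser c) v = (∂ₛa)₂(v)`). VOCABULARY: for kernel vectors `λ, v` of `P` the POLAR is
`polar(λ, v) = Σₛ λₛ (∂ₛa)₂(v)` (the polar of the kernel cubic in direction `λ`, at `v`); a NULL POLAR is a kernel `λ`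
with `polar(λ, ·) ≡ 0` on `ker P`; they form a subspace `N ≤ ker P`. The near vector of a chart `i` and a translation `τ`
is `w = (τ with w_i = 1)`; a near vector is FREE when some kernel polar is non-zero at it (successor corank `0`) and a
SATELLITE when all vanish (successor corank `2`). They are NOT statements of H. Hironaka's manuscript [Hironaka2017] and
use nothing from it; each docstring says which printed item's ROLE the statement replaces (Th. 16.6 p.84: the next
centre `D′ = ∇′ ∩ π⁻¹(D)` and the determinacy / finiteness of the continuation of the singular chain), under
adjudication, never as fact. No FACT-LIST premise occurs. AI bookkeeping, weaker than expert review.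

WHAT THE PACKAGE SAYS (proved at `p = 2` for every `n` in this seat's gen-6 files
`…HypersurfacesCharTwo{NullPolar,CubicPolarization,FreePoints}.lean`, p542945 / p543928 / the FreePoints file; closers
by name in `…HypersurfacesCharTwoCensusProof.lean`). At corank `e = 2`: (1) **`h₂ = 1 + dim N`** — a non-zero null polar
forces `h₂ ≥ 2` (all relations among the six spanning classes `1, x, y, x², xy, y²` of `κ⟦u⟧/((∂a)+𝔪³)` lie on one
line), so with gen 5 (p531822: `h₂ = 3 ⟺ N = ker P`; p538084: `h₂ ≥ 2 ⟹ N ≠ 0`) `h₂ = 1 ⟺ N = 0`, `h₂ = 2 ⟺ N` is a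
line, `h₂ = 3 ⟺ N = ker P` — in the binary normal form `g = αs³+βs²t+γst²+δt³` of the kernel cubic,
`h₂ = 3 − rank [[α,γ],[β,δ]]`; (2) CUBIC POLARIZATION `a₃(v+λ) = a₃(v) + polar(λ,v) + polar(v,λ) + a₃(λ)`, so over a
field with more than three elements value-wise vanishing of `a₃` on the kernel is form-wise (`h₂ = 3`), and therefore an
isolated corank-two `p`-fold point with `h₂ ≤ 2` has AT MOST THREE infinitely-near `p`-fold points over EVERY field (no
value hypothesis; over `𝔽₂` the kernel plane has three non-zero vectors); (3) FREE POINTS: two non-proportional free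
near points force `h₂ = 1`, so at `h₂ = 2` there is at most one free near point and (with p536239's unique satellite)
AT MOST TWO near `p`-fold points; at `h₂ ≤ 2` every `p`-fold successor of an isolated state is either a satellite
successor (corank `2`, isolated, `μ` drops) or a free one (corank `0`, isolated, `μ = 1`, nothing after it).
THE CENSUS (isolated, `e = 2`): `h₂ = 1`: `≤ 3` near points, all free · `h₂ = 2`: `≤ 1` satellite (`= 1` over a perfect
field) + `≤ 1` free · `h₂ = 3`: the whole kernel line, none isolated (gen 4/5).

REV 2 (same seat, gen 6, APPEND-ONLY: the twelve rev-1 predicates are byte-identical; one import added —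
`Mathlib.FieldTheory.Perfect`; five predicates appended): THE SATELLITE SPINE AND THE CUBE CRITERION.
`CampaignW46HypersurfacesSatelliteSpine` (PERFECT field, isolated `(e, h₂) = (2, 2)`: chart/translation words and a length
`k ≥ 1`, `k + 4 ≤ μ`, along which every node is an isolated corank-two `p`-fold point, the first `k` nodes have `h₂ = 2` with
`μ` strictly decreasing, and the end node has `h₂ ∈ {1, 3}` — the satellite chain is FORCED and finite),
`CampaignW46HypersurfacesSpineEnd` (isolated corank two: `h₂ = 1` ⇒ `μ = 4`, at most three near `p`-fold points, all free leaves;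
`h₂ = 3` ⇒ every `p`-fold successor NON-isolated and every kernel direction a near `p`-fold point),
`CampaignW46HypersurfacesCaterpillar` (perfect field: along the spine every `p`-fold successor of a node is the next node up to
proportionality or a free leaf; the end node is a three-tangents node with `μ = 4` and free leaves only, or a no-tangent node with
only non-isolated successors), `CampaignW46HypersurfacesCubeCriterion` (isolated `(2,2)` with satellite direction `w₀`: a FREE near
`p`-fold point exists IFF `w₀` is not a null polar — kernel cubic `ℓ₁²ℓ₂` versus `ℓ₁³`) and `CampaignW46HypersurfacesHilbertTwoExactCount`
(perfect field, isolated `(2,2)`: a satellite `w₀` exists and EITHER there are both a corank-two and a corank-zero `p`-fold successor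
— exactly two near points with rev 1's bounds — OR every `p`-fold successor sits at `[w₀]` with corank two — exactly one). Their
`p = 2` instances are PROVED for every `n` in `…HypersurfacesCharTwo{Spine,CubeCriterion}.lean` (p548115, the CubeCriterion file);
closers appended to `…CensusProof.lean`.

REV 3 (same seat, gen 6, APPEND-ONLY: the seventeen rev-1/rev-2 predicates are byte-identical; two predicates appended): THE
NEAR-POINT DICHOTOMY. `CampaignW46HypersurfacesNearDichotomy` (every dimension, every corank, every field: an ISOLATED hypersurface
`p`-fold point has EITHER at most three infinitely-near `p`-fold points, all isolated with smaller Milnor number, OR only NON-isolated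
ones — then `e ≥ 3` or `(e, h₂) = (2, 3)`) and `CampaignW46FourfoldsOrdTwoCensus` (`n = 4`, order-`p`-cleaned isolated `p`-fold points:
`e ∈ {0, 2}`; `e = 0`: no near `p`-fold point; `(2,1)`: `≤ 3`, `(2,2)`: `≤ 2`, all isolated with `μ`-drop; `(2,3)`: only non-isolated
successors — the slot's target class «n ≥ 3, order-2 cleaned» in dimension four). Their `p = 2` instances are PROVED in
`…HypersurfacesCharTwoNearDichotomy.lean` (the NearDichotomy file); closers appended to `…CensusProof.lean`.

REV 4 (same seat, gen 6, APPEND-ONLY: the nineteen rev-1/2/3 predicates are byte-identical; one predicate appended): TWO FREE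
POINTS GIVE A THIRD. `CampaignW46HypersurfacesThirdFreePoint` (isolated corank two: two `p`-fold successors of corank `0` with
non-proportional near vectors force a third one, of corank `0`, with near vector proportional to neither — so the three-tangents class
has `0`, `1` or `3` infinitely-near `p`-fold points, never `2`). Its `p = 2` instance is PROVED in `…HypersurfacesCharTwoThirdPoint.lean`
(p555329: the third root `[m₂w₁ + m₁w₂]` of the kernel cubic `st(m₁s + m₂t)`); closer appended to `…CensusProof.lean`.

REV 5 (same seat, gen 6, APPEND-ONLY: the twenty rev-1/2/3/4 predicates are byte-identical; one import added —
`Mathlib.FieldTheory.IsAlgClosed.Basic`; one predicate appended): EXACTLY THREE. `CampaignW46HypersurfacesThreeTangentsClosed`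
(ALGEBRAICALLY CLOSED field, isolated `(e, h₂) = (2, 1)`: three `p`-fold successors of corank `0` with pairwise non-proportional near
vectors — with rev 1's `…CorankTwoCountHilbert` (`≤ 3`): EXACTLY THREE infinitely-near `p`-fold points, the `D₄` configuration). Its
`p = 2` instance is PROVED in `…HypersurfacesCharTwoThreeTangentsClosed.lean` (the kernel cubic along a line has a root; next to a free
near point the quadratic coefficient is a non-zero polar; two free points give a third, p555329); closer appended to `…CensusProof.lean`.

## References

* [GreuelPfister2026] G.-M. Greuel, G. Pfister, The splitting lemma in any characteristic, J. Algebra 689 (2026)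
  = arXiv:2507.17078, Thm 3.5 and Cor 3.7 (hyperbolic pairs in characteristic two: context of `e`, `P`).
* [CasasAlvero2000] E. Casas-Alvero, Singularities of Plane Curves, LMS LN 276 (2000), §3 (free and satellite
  infinitely near points of plane curves: context for the names only).
* [Hironaka2017] H. Hironaka, ms. 2017-03-23, Th. 16.6 p.84, §16.3 / Th. 16.13 p.87 — ROLE replaced only.
-/

noncomputable section

set_option linter.dupNamespace false -- mandated namespace of this single-conjunct summit

open scoped Classical

namespace Summit.ResolutionOfSingularities.ResolutionOfSingularities.Theorems

/-- [OURS · L1 W4.6 rung (ii), every dimension; census rev 1] replaces the role of NOTHING printed (a structural fact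
of OUR invariants `h₂`, `P`, `a₃`: the Hilbert function of the Milnor algebra at degree two read off the 3-jet); NOT a
statement of the manuscript. For every field `κ` of characteristic `p`, every `p`-fold state `c` of `z^p = a(u₁,…,uₙ)`
with `e(c) = 2`, and every NON-ZERO kernel vector `λ₀` of the polar matrix whose polar `v ↦ Σₛ λ₀ₛ (∂ₛa)₂(v)` vanishes at
every kernel vector (a non-zero NULL POLAR): `h₂(c) ≥ 2`. Instance `p = 2` PROVED for every `n` by
`CampaignW46.HypersurfacesCharTwo.hypersurface_two_le_milnorHilbertTwo_of_null_polar` (p542945: all relations among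
the six spanning classes of `κ⟦u⟧/((∂a)+𝔪³)` lie on one line); other `p` not claimed. [folklore] -/
def CampaignW46HypersurfacesNullPolarHilbertTwo (p n : ℕ) : Prop :=
  ∀ (κ : Type) [Field κ] [CharP κ p] (c : (Fin n → ℕ) → κ) (lam₀ : Fin n → κ),
    WildCones.MultP p n κ c → CampaignW46.milnorEmbDim p n κ c = 2 → lam₀ ≠ 0 →
      Matrix.vecMul lam₀ (Matrix.of fun s t : Fin n => if s = t then (0 : κ)
        else MvPowerSeries.coeff (Finsupp.single s 1 + Finsupp.single t 1) (WildCones.ser p n κ c)) = 0 →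
        (∀ v : Fin n → κ,
          Matrix.vecMul v (Matrix.of fun s t : Fin n => if s = t then (0 : κ)
            else MvPowerSeries.coeff (Finsupp.single s 1 + Finsupp.single t 1) (WildCones.ser p n κ c)) = 0 →
            ∑ s, lam₀ s * CampaignW46.degForm 2
              (Literature.AlgebraicGeometry.Resolution.MvPowerSeries.pderiv s (WildCones.ser p n κ c)) v = 0) →
          2 ≤ CampaignW46.milnorHilbertTwo p n κ c

/-- [OURS · L1 W4.6 rung (ii), every dimension; census rev 1] replaces the role of NOTHING printed (the
three-tangents class of OUR invariants, read off the polar pencil of the kernel cubic); NOT a statement of the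
manuscript. For every field `κ` of characteristic `p` and every `p`-fold state `c` of `z^p = a(u₁,…,uₙ)` with
`e(c) = 2`: `h₂(c) = 1` IF AND ONLY IF the only kernel vector `λ` of the polar matrix whose polar vanishes at every
kernel vector is `λ = 0` (the null-polar space is `N = 0`; binary normal form: the kernel cubic is square-free, three
distinct tangents over the algebraic closure — gen 4's `D₄` class). Instance `p = 2` PROVED for every `n` by
`CampaignW46.HypersurfacesCharTwo.hypersurface_milnorHilbertTwo_eq_one_iff_no_null_polar` (p542945, with p538084's
dimension count for `⇐`); other `p` not claimed. [folklore] -/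
def CampaignW46HypersurfacesHilbertOneIffNoNullPolar (p n : ℕ) : Prop :=
  ∀ (κ : Type) [Field κ] [CharP κ p] (c : (Fin n → ℕ) → κ),
    WildCones.MultP p n κ c → CampaignW46.milnorEmbDim p n κ c = 2 →
      (CampaignW46.milnorHilbertTwo p n κ c = 1 ↔
        ∀ lam : Fin n → κ,
          Matrix.vecMul lam (Matrix.of fun s t : Fin n => if s = t then (0 : κ)
            else MvPowerSeries.coeff (Finsupp.single s 1 + Finsupp.single t 1) (WildCones.ser p n κ c)) = 0 →
          (∀ v : Fin n → κ,
            Matrix.vecMul v (Matrix.of fun s t : Fin n => if s = t then (0 : κ)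
              else MvPowerSeries.coeff (Finsupp.single s 1 + Finsupp.single t 1) (WildCones.ser p n κ c)) = 0 →
              ∑ s, lam s * CampaignW46.degForm 2
                (Literature.AlgebraicGeometry.Resolution.MvPowerSeries.pderiv s (WildCones.ser p n κ c)) v = 0) →
            lam = 0)

/-- [OURS · L1 W4.6 rung (ii), every dimension; census rev 1] replaces the role of NOTHING printed (the
multiple-tangent class of OUR invariants, read off the polar pencil of the kernel cubic); NOT a statement of the
manuscript. For every field `κ` of characteristic `p` and every `p`-fold state `c` of `z^p = a(u₁,…,uₙ)` with
`e(c) = 2`: `h₂(c) = 2` IF AND ONLY IF a NON-ZERO null polar exists AND some polar value `Σₛ λₛ (∂ₛa)₂(v)`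
(`λ, v ∈ ker P`) is non-zero — the null polars form a LINE. With `CampaignW46HypersurfacesHilbertOneIffNoNullPolar`
and p540412's `CampaignW46HypersurfacesHilbertThreeIffPolar` (`h₂ = 3` ⟺ every kernel vector is a null polar) this is
the formula `h₂ = 1 + dim N`. Instance `p = 2` PROVED for every `n` by
`CampaignW46.HypersurfacesCharTwo.hypersurface_milnorHilbertTwo_eq_two_iff_null_polar_line` (p542945); other `p` not
claimed. [folklore] -/
def CampaignW46HypersurfacesHilbertTwoIffNullPolarLine (p n : ℕ) : Prop :=
  ∀ (κ : Type) [Field κ] [CharP κ p] (c : (Fin n → ℕ) → κ),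
    WildCones.MultP p n κ c → CampaignW46.milnorEmbDim p n κ c = 2 →
      (CampaignW46.milnorHilbertTwo p n κ c = 2 ↔
        (∃ lam : Fin n → κ, lam ≠ 0 ∧
          Matrix.vecMul lam (Matrix.of fun s t : Fin n => if s = t then (0 : κ)
            else MvPowerSeries.coeff (Finsupp.single s 1 + Finsupp.single t 1) (WildCones.ser p n κ c)) = 0 ∧
          ∀ v : Fin n → κ,
            Matrix.vecMul v (Matrix.of fun s t : Fin n => if s = t then (0 : κ)
              else MvPowerSeries.coeff (Finsupp.single s 1 + Finsupp.single t 1) (WildCones.ser p n κ c)) = 0 →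
              ∑ s, lam s * CampaignW46.degForm 2
                (Literature.AlgebraicGeometry.Resolution.MvPowerSeries.pderiv s (WildCones.ser p n κ c)) v = 0) ∧
        ∃ lam v : Fin n → κ,
          Matrix.vecMul lam (Matrix.of fun s t : Fin n => if s = t then (0 : κ)
            else MvPowerSeries.coeff (Finsupp.single s 1 + Finsupp.single t 1) (WildCones.ser p n κ c)) = 0 ∧
          Matrix.vecMul v (Matrix.of fun s t : Fin n => if s = t then (0 : κ)
            else MvPowerSeries.coeff (Finsupp.single s 1 + Finsupp.single t 1) (WildCones.ser p n κ c)) = 0 ∧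
            ∑ s, lam s * CampaignW46.degForm 2
              (Literature.AlgebraicGeometry.Resolution.MvPowerSeries.pderiv s (WildCones.ser p n κ c)) v ≠ 0)

/-- [OURS · L1 W4.6 rung (ii), every dimension; census rev 1] replaces the role of NOTHING printed (the null polars of
OUR kernel cubic form at most a line outside the no-tangent class); NOT a statement of the manuscript. For every field
`κ` of characteristic `p`, every `p`-fold state `c` of `z^p = a(u₁,…,uₙ)` with `e(c) = 2` and `h₂(c) ≤ 2`, and kernel
vectors `λ₁ ≠ 0`, `λ₂` of the polar matrix which are both null polars (their polars vanish at every kernel vector):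
`λ₂` is a multiple of `λ₁` (two independent null polars would make every polar vanish, `h₂ = 3`). Instance `p = 2`
PROVED for every `n` by `CampaignW46.HypersurfacesCharTwo.hypersurface_null_polar_unique` (p542945); other `p` not
claimed. [folklore] -/
def CampaignW46HypersurfacesNullPolarUnique (p n : ℕ) : Prop :=
  ∀ (κ : Type) [Field κ] [CharP κ p] (c : (Fin n → ℕ) → κ) (lam₁ lam₂ : Fin n → κ),
    WildCones.MultP p n κ c → CampaignW46.milnorEmbDim p n κ c = 2 → CampaignW46.milnorHilbertTwo p n κ c ≤ 2 →
      lam₁ ≠ 0 →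
      Matrix.vecMul lam₁ (Matrix.of fun s t : Fin n => if s = t then (0 : κ)
        else MvPowerSeries.coeff (Finsupp.single s 1 + Finsupp.single t 1) (WildCones.ser p n κ c)) = 0 →
      Matrix.vecMul lam₂ (Matrix.of fun s t : Fin n => if s = t then (0 : κ)
        else MvPowerSeries.coeff (Finsupp.single s 1 + Finsupp.single t 1) (WildCones.ser p n κ c)) = 0 →
        (∀ v : Fin n → κ,
          Matrix.vecMul v (Matrix.of fun s t : Fin n => if s = t then (0 : κ)
            else MvPowerSeries.coeff (Finsupp.single s 1 + Finsupp.single t 1) (WildCones.ser p n κ c)) = 0 →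
            ∑ s, lam₁ s * CampaignW46.degForm 2
              (Literature.AlgebraicGeometry.Resolution.MvPowerSeries.pderiv s (WildCones.ser p n κ c)) v = 0) →
        (∀ v : Fin n → κ,
          Matrix.vecMul v (Matrix.of fun s t : Fin n => if s = t then (0 : κ)
            else MvPowerSeries.coeff (Finsupp.single s 1 + Finsupp.single t 1) (WildCones.ser p n κ c)) = 0 →
            ∑ s, lam₂ s * CampaignW46.degForm 2
              (Literature.AlgebraicGeometry.Resolution.MvPowerSeries.pderiv s (WildCones.ser p n κ c)) v = 0) →
          ∃ r : κ, lam₂ = r • lam₁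

/-- [OURS · L1 W4.6 rung (ii), every dimension; census rev 1] replaces the role of NOTHING printed (multilinear
algebra of OUR tangent cubic); NOT a statement of the manuscript. CUBIC POLARIZATION: for every field `κ` of
characteristic `p`, every series `f ∈ κ⟦X₁,…,Xₙ⟧` and vectors `v, v'`,
`degForm 3 f (v + v') = degForm 3 f v + Σₛ v'ₛ · degForm 2 (∂ₛf) v + Σₛ vₛ · degForm 2 (∂ₛf) v' + degForm 3 f v'`
(the bidegree-`(2,1)` and `(1,2)` parts of a cubic form are its two polars; true in every characteristic). Instance
`p = 2` PROVED for every `n` by `CampaignW46.HypersurfacesCharTwo.degForm_three_add` (p543928: Euler `f₃(w) = polar(w,w)`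
in characteristic two, quadratic polarization p536239, `D_vD_v f = 0`); other `p` not claimed here. [folklore] -/
def CampaignW46HypersurfacesCubicPolarization (p n : ℕ) : Prop :=
  ∀ (κ : Type) [Field κ] [CharP κ p] (f : MvPowerSeries (Fin n) κ) (v v' : Fin n → κ),
    CampaignW46.degForm 3 f (v + v') = CampaignW46.degForm 3 f v +
      ∑ s, v' s * CampaignW46.degForm 2 (Literature.AlgebraicGeometry.Resolution.MvPowerSeries.pderiv s f) v +
      ∑ s, v s * CampaignW46.degForm 2 (Literature.AlgebraicGeometry.Resolution.MvPowerSeries.pderiv s f) v' +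
        CampaignW46.degForm 3 f v'

/-- [OURS · L1 W4.6 rung (ii), every dimension; census rev 1] replaces the role of NOTHING printed (the no-tangent
class of OUR invariants detected by VALUES of the tangent cubic); NOT a statement of the manuscript. For every field
`κ` of characteristic `p` WITH MORE THAN THREE ELEMENTS (a finite set of field elements of size `> 3` exists; in
characteristic two: every field except `𝔽₂`), and every `p`-fold state `c` of `z^p = a(u₁,…,uₙ)` with `e(c) = 2`: if the
tangent cubic `a₃` vanishes at EVERY kernel vector of the polar matrix, then `h₂(c) = 3` (the cubic `x ↦ a₃(v + xλ)`
vanishes identically, so all polars vanish on the kernel; p540412's `…HilbertThreeIffPolar`). Over `𝔽₂` this fails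
form-wise/value-wise (`st(s+t)`). Instance `p = 2` PROVED for every `n` by
`CampaignW46.HypersurfacesCharTwo.hypersurface_milnorHilbertTwo_eq_three_of_cubic_values` (p543928); other `p` not
claimed. [folklore] -/
def CampaignW46HypersurfacesCubicValuesHilbertThree (p n : ℕ) : Prop :=
  ∀ (κ : Type) [Field κ] [CharP κ p], (∃ s : Finset κ, 3 < s.card) → ∀ (c : (Fin n → ℕ) → κ),
    WildCones.MultP p n κ c → CampaignW46.milnorEmbDim p n κ c = 2 →
      (∀ w : Fin n → κ,
        Matrix.vecMul w (Matrix.of fun s t : Fin n => if s = t then (0 : κ)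
          else MvPowerSeries.coeff (Finsupp.single s 1 + Finsupp.single t 1) (WildCones.ser p n κ c)) = 0 →
          CampaignW46.degForm 3 (WildCones.ser p n κ c) w = 0) →
        CampaignW46.milnorHilbertTwo p n κ c = 3

/-- [OURS · L1 W4.6 rung (ii), every dimension, EVERY field; census rev 1] replaces the role of the FINITENESS of the
set of next centres (Th. 16.6 p.84 L5–L6, `D′ = ∇′ ∩ π⁻¹(D)` a finite set of closed points) for isolated corank-two
hypersurface `p`-fold points with `h₂ ≤ 2`, WITHOUT the value hypothesis of p540412's `…CorankTwoCount`; NOT a statement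
of the manuscript. For every field `κ` of characteristic `p`, every ISOLATED `p`-fold state `c` of `z^p = a(u₁,…,uₙ)` with
`e(c) = 2` and `h₂(c) ≤ 2`: there is a finite set `S` of AT MOST THREE vectors such that for every chart `i` and
translation `τ` with a `p`-fold successor the near vector `(τ with i ↦ 1)` is a multiple of a member of `S` (at most
three points of the kernel line `ℙ(ker P)`). Instance `p = 2` PROVED for every `n` by
`CampaignW46.HypersurfacesCharTwo.hypersurface_nearPoints_le_three_of_milnorHilbertTwo_le_two` (p543928: outside `𝔽₂` a
kernel value `a₃(v) ≠ 0` exists and p525636 counts; over `𝔽₂` the kernel plane has three non-zero vectors); other `p`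
not claimed. [cite: CasasAlvero2000, §3] -/
def CampaignW46HypersurfacesCorankTwoCountHilbert (p n : ℕ) : Prop :=
  ∀ (κ : Type) [Field κ] [CharP κ p] (c : (Fin n → ℕ) → κ),
    WildCones.MultP p n κ c → WildCones.Isol p n κ c → CampaignW46.milnorEmbDim p n κ c = 2 →
      CampaignW46.milnorHilbertTwo p n κ c ≤ 2 →
        ∃ S : Finset (Fin n → κ), S.card ≤ 3 ∧
          ∀ (i : Fin n) (τ : Fin n → κ), WildCones.MultP p n κ (WildCones.step p n κ i τ c) →
            ∃ w ∈ S, ∃ r : κ, Function.update τ i 1 = r • w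

/-- [OURS · L1 W4.6 rung (ii), every dimension, EVERY field; census rev 1] replaces the role of the DESCRIPTION AND
FATE of the next centres (Th. 16.6 p.84 L4–L6) for the three-tangents class of isolated corank-two hypersurface
`p`-fold points — THE `D₄` LINE OF THE CENSUS; NOT a statement of the manuscript. For every field `κ` of
characteristic `p`, every isolated `p`-fold state `c` of `z^p = a(u₁,…,uₙ)` with `e(c) = 2` and `h₂(c) = 1`: (a) at most
THREE infinitely-near `p`-fold points (a set `S` of `≤ 3` vectors as above), and (b) every `p`-fold successor
`step i τ c` has corank `0`, is isolated with `μ = 1`, and NO `p`-fold point follows it in any chart — the tree of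
infinitely-near `p`-fold points above `c` is the root with at most three leaves. Instance `p = 2` PROVED for every
`n` by `CampaignW46.HypersurfacesCharTwo.hypersurface_near_census_of_milnorHilbertTwo_eq_one` (p543928, with gen 4's
p513980); other `p` not claimed. [cite: CasasAlvero2000, §3] -/
def CampaignW46HypersurfacesHilbertOneCensus (p n : ℕ) : Prop :=
  ∀ (κ : Type) [Field κ] [CharP κ p] (c : (Fin n → ℕ) → κ),
    WildCones.MultP p n κ c → WildCones.Isol p n κ c → CampaignW46.milnorEmbDim p n κ c = 2 →
      CampaignW46.milnorHilbertTwo p n κ c = 1 →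
        (∃ S : Finset (Fin n → κ), S.card ≤ 3 ∧
          ∀ (i : Fin n) (τ : Fin n → κ), WildCones.MultP p n κ (WildCones.step p n κ i τ c) →
            ∃ w ∈ S, ∃ r : κ, Function.update τ i 1 = r • w) ∧
        ∀ (i : Fin n) (τ : Fin n → κ), WildCones.MultP p n κ (WildCones.step p n κ i τ c) →
          CampaignW46.milnorEmbDim p n κ (WildCones.step p n κ i τ c) = 0 ∧
            WildCones.Isol p n κ (WildCones.step p n κ i τ c) ∧ WildCones.mu p n κ (WildCones.step p n κ i τ c) = 1 ∧
              ∀ (i' : Fin n) (τ' : Fin n → κ),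
                ¬ WildCones.MultP p n κ (WildCones.step p n κ i' τ' (WildCones.step p n κ i τ c))

/-- [OURS · L1 W4.6 rung (ii), every dimension; census rev 1] replaces the role of NOTHING printed (two free
infinitely-near points of OUR dynamics detect the three-tangents class); NOT a statement of the manuscript. For every
field `κ` of characteristic `p`, every `p`-fold state `c` of `z^p = a(u₁,…,uₙ)` with `e(c) = 2`, and kernel vectors
`w₁ ≠ 0`, `w₂` of the polar matrix, `w₂` not a multiple of `w₁`, both ON the tangent cubic (`a₃(wᵢ) = 0`) and both FREE
(for each, some kernel polar is non-zero at it): `h₂(c) = 1` (two distinct simple roots make the kernel cubic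
square-free). Instance `p = 2` PROVED for every `n` by
`CampaignW46.HypersurfacesCharTwo.hypersurface_two_free_points_milnorHilbertTwo_eq_one` (the FreePoints file, via
p542945); other `p` not claimed. [cite: CasasAlvero2000, §3] -/
def CampaignW46HypersurfacesTwoFreeHilbertOne (p n : ℕ) : Prop :=
  ∀ (κ : Type) [Field κ] [CharP κ p] (c : (Fin n → ℕ) → κ) (w₁ w₂ : Fin n → κ),
    WildCones.MultP p n κ c → CampaignW46.milnorEmbDim p n κ c = 2 → w₁ ≠ 0 →
      Matrix.vecMul w₁ (Matrix.of fun s t : Fin n => if s = t then (0 : κ)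
        else MvPowerSeries.coeff (Finsupp.single s 1 + Finsupp.single t 1) (WildCones.ser p n κ c)) = 0 →
      Matrix.vecMul w₂ (Matrix.of fun s t : Fin n => if s = t then (0 : κ)
        else MvPowerSeries.coeff (Finsupp.single s 1 + Finsupp.single t 1) (WildCones.ser p n κ c)) = 0 →
        (∀ r : κ, w₂ ≠ r • w₁) →
        CampaignW46.degForm 3 (WildCones.ser p n κ c) w₁ = 0 → CampaignW46.degForm 3 (WildCones.ser p n κ c) w₂ = 0 →
          (∃ v : Fin n → κ,
            Matrix.vecMul v (Matrix.of fun s t : Fin n => if s = t then (0 : κ)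
              else MvPowerSeries.coeff (Finsupp.single s 1 + Finsupp.single t 1) (WildCones.ser p n κ c)) = 0 ∧
              ∑ s, v s * CampaignW46.degForm 2
                (Literature.AlgebraicGeometry.Resolution.MvPowerSeries.pderiv s (WildCones.ser p n κ c)) w₁ ≠ 0) →
          (∃ v : Fin n → κ,
            Matrix.vecMul v (Matrix.of fun s t : Fin n => if s = t then (0 : κ)
              else MvPowerSeries.coeff (Finsupp.single s 1 + Finsupp.single t 1) (WildCones.ser p n κ c)) = 0 ∧
              ∑ s, v s * CampaignW46.degForm 2
                (Literature.AlgebraicGeometry.Resolution.MvPowerSeries.pderiv s (WildCones.ser p n κ c)) w₂ ≠ 0) →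
            CampaignW46.milnorHilbertTwo p n κ c = 1

/-- [OURS · L1 W4.6 rung (ii), every dimension; census rev 1] replaces the role of the DETERMINACY of the free
continuation of the singular chain (Th. 16.6 p.84 L4–L6) for corank-two hypersurface `p`-fold points outside the
three-tangents class; NOT a statement of the manuscript. For every field `κ` of characteristic `p`, every `p`-fold state
`c` of `z^p = a(u₁,…,uₙ)` with `e(c) = 2` and `h₂(c) ≥ 2`, and charts/translations `(i, τ)`, `(i', τ')` whose successors
are `p`-fold points of corank `0` (FREE successors): the near vector of `(i', τ')` is a multiple of that of `(i, τ)` —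
AT MOST ONE free infinitely-near `p`-fold point. Instance `p = 2` PROVED for every `n` by
`CampaignW46.HypersurfacesCharTwo.hypersurface_free_successors_proportional` (the FreePoints file); other `p` not
claimed. [cite: CasasAlvero2000, §3] -/
def CampaignW46HypersurfacesFreeUnique (p n : ℕ) : Prop :=
  ∀ (κ : Type) [Field κ] [CharP κ p] (c : (Fin n → ℕ) → κ) (i i' : Fin n) (τ τ' : Fin n → κ),
    WildCones.MultP p n κ c → CampaignW46.milnorEmbDim p n κ c = 2 → 2 ≤ CampaignW46.milnorHilbertTwo p n κ c →
      WildCones.MultP p n κ (WildCones.step p n κ i τ c) → WildCones.MultP p n κ (WildCones.step p n κ i' τ' c) →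
        CampaignW46.milnorEmbDim p n κ (WildCones.step p n κ i τ c) = 0 →
          CampaignW46.milnorEmbDim p n κ (WildCones.step p n κ i' τ' c) = 0 →
            ∃ r : κ, Function.update τ' i' 1 = r • Function.update τ i 1

/-- [OURS · L1 W4.6 rung (ii), every dimension, EVERY field; census rev 1] replaces the role of the FINITENESS of the
set of next centres (Th. 16.6 p.84 L5–L6) for the multiple-tangent class of corank-two hypersurface `p`-fold points,
sharpened; NOT a statement of the manuscript. For every field `κ` of characteristic `p`, every `p`-fold state `c` of
`z^p = a(u₁,…,uₙ)` with `e(c) = 2` and `h₂(c) = 2`: there is a finite set `S` of AT MOST TWO vectors such that for every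
chart `i` and translation `τ` with a `p`-fold successor the near vector `(τ with i ↦ 1)` is a multiple of a member of
`S` — at most one satellite direction (p540412's `…SatelliteUnique`) and at most one free direction
(`CampaignW46HypersurfacesFreeUnique`). Instance `p = 2` PROVED for every `n` by
`CampaignW46.HypersurfacesCharTwo.hypersurface_nearPoints_le_two_of_milnorHilbertTwo_eq_two` (the FreePoints file);
other `p` not claimed. [cite: CasasAlvero2000, §3] -/
def CampaignW46HypersurfacesHilbertTwoCount (p n : ℕ) : Prop :=
  ∀ (κ : Type) [Field κ] [CharP κ p] (c : (Fin n → ℕ) → κ),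
    WildCones.MultP p n κ c → CampaignW46.milnorEmbDim p n κ c = 2 → CampaignW46.milnorHilbertTwo p n κ c = 2 →
      ∃ S : Finset (Fin n → κ), S.card ≤ 2 ∧
        ∀ (i : Fin n) (τ : Fin n → κ), WildCones.MultP p n κ (WildCones.step p n κ i τ c) →
          ∃ w ∈ S, ∃ r : κ, Function.update τ i 1 = r • w

/-- [OURS · L1 W4.6 rung (ii), every dimension, EVERY field; census rev 1] replaces the role of the FATE of the next
centres (Th. 16.6 p.84 L4–L6: the new centre is again a point of the same kind, or the multiplicity drops) for
isolated corank-two hypersurface `p`-fold points with `h₂ ≤ 2`; NOT a statement of the manuscript. THE SUCCESSOR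
DICHOTOMY: for every field `κ` of characteristic `p`, every isolated `p`-fold state `c` of `z^p = a(u₁,…,uₙ)` with
`e(c) = 2`, `h₂(c) ≤ 2`, and every chart `i` and translation `τ` whose successor is a `p`-fold point: EITHER the
successor has corank `2`, is isolated and has smaller Milnor number (a SATELLITE successor), OR it has corank `0`, is
isolated with `μ = 1`, and no `p`-fold point follows it (a FREE successor). Instance `p = 2` PROVED for every `n` by
`CampaignW46.HypersurfacesCharTwo.hypersurface_successor_dichotomy_of_milnorHilbertTwo_le_two` (the FreePoints file,
from p533887 and gen 4's isolatedness transfer p514670); other `p` not claimed. [cite: CasasAlvero2000, §3] -/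
def CampaignW46HypersurfacesSuccessorDichotomy (p n : ℕ) : Prop :=
  ∀ (κ : Type) [Field κ] [CharP κ p] (c : (Fin n → ℕ) → κ) (i : Fin n) (τ : Fin n → κ),
    WildCones.MultP p n κ c → WildCones.Isol p n κ c → CampaignW46.milnorEmbDim p n κ c = 2 →
      CampaignW46.milnorHilbertTwo p n κ c ≤ 2 → WildCones.MultP p n κ (WildCones.step p n κ i τ c) →
        (CampaignW46.milnorEmbDim p n κ (WildCones.step p n κ i τ c) = 2 ∧
            WildCones.Isol p n κ (WildCones.step p n κ i τ c) ∧
              WildCones.mu p n κ (WildCones.step p n κ i τ c) < WildCones.mu p n κ c) ∨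
          (CampaignW46.milnorEmbDim p n κ (WildCones.step p n κ i τ c) = 0 ∧
            WildCones.Isol p n κ (WildCones.step p n κ i τ c) ∧ WildCones.mu p n κ (WildCones.step p n κ i τ c) = 1 ∧
              ∀ (i' : Fin n) (τ' : Fin n → κ),
                ¬ WildCones.MultP p n κ (WildCones.step p n κ i' τ' (WildCones.step p n κ i τ c)))

/-- [OURS · L1 W4.6 rung (ii), every dimension, PERFECT field; census rev 2] replaces the role of the DETERMINACY AND FINITENESS
of the continuation of the singular chain (Th. 16.6 p.84 L4–L6) for the multiple-tangent class of isolated corank-two hypersurface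
`p`-fold points of route WildCones' dynamics; NOT a statement of the manuscript. THE SATELLITE SPINE: for every perfect field `κ` of
characteristic `p` and every isolated `p`-fold state `c` of `z^p = a(u₁,…,uₙ)` with `e(c) = 2`, `h₂(c) = 2`, there are a chart word
`i`, a translation word `t` and a length `k ≥ 1` with `k + 4 ≤ μ(c)` such that, along `c_m = run c i t m`: every `c_m` (`m ≤ k`) is an
isolated `p`-fold point of corank `2`; for `m < k`, `h₂(c_m) = 2`, `e(c_{m+1}) = 2` and `μ(c_{m+1}) < μ(c_m)`; and `h₂(c_k) = 1` or
`h₂(c_k) = 3`. Instance `p = 2` PROVED for every `n` by `CampaignW46.HypersurfacesCharTwo.hypersurface_satellite_spine` (p548115);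
other `p` not claimed. [cite: CasasAlvero2000, §3] -/
def CampaignW46HypersurfacesSatelliteSpine (p n : ℕ) : Prop :=
  ∀ (κ : Type) [Field κ] [CharP κ p] [PerfectField κ] (c : (Fin n → ℕ) → κ),
    WildCones.MultP p n κ c → WildCones.Isol p n κ c → CampaignW46.milnorEmbDim p n κ c = 2 →
      CampaignW46.milnorHilbertTwo p n κ c = 2 →
        ∃ (i : ℕ → Fin n) (t : ℕ → Fin n → κ) (k : ℕ), 1 ≤ k ∧ k + 4 ≤ WildCones.mu p n κ c ∧
          (∀ m ≤ k, WildCones.MultP p n κ (WildCones.run p n κ c i t m) ∧ WildCones.Isol p n κ (WildCones.run p n κ c i t m) ∧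
            CampaignW46.milnorEmbDim p n κ (WildCones.run p n κ c i t m) = 2) ∧
          (∀ m < k, CampaignW46.milnorHilbertTwo p n κ (WildCones.run p n κ c i t m) = 2 ∧
            CampaignW46.milnorEmbDim p n κ (WildCones.run p n κ c i t (m + 1)) = 2 ∧
              WildCones.mu p n κ (WildCones.run p n κ c i t (m + 1)) < WildCones.mu p n κ (WildCones.run p n κ c i t m)) ∧
          (CampaignW46.milnorHilbertTwo p n κ (WildCones.run p n κ c i t k) = 1 ∨
            CampaignW46.milnorHilbertTwo p n κ (WildCones.run p n κ c i t k) = 3)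

/-- [OURS · L1 W4.6 rung (ii), every dimension; census rev 2] replaces the role of the FATE of the next centres (Th. 16.6 p.84 L4–L6)
at the END of the satellite spine of an isolated corank-two hypersurface `p`-fold point; NOT a statement of the manuscript. For every
field `κ` of characteristic `p` and every isolated `p`-fold state `c` of `z^p = a(u₁,…,uₙ)` with `e(c) = 2`: (a) if `h₂(c) = 1` then
`μ(c) = 4`, there is a set `S` of at most THREE vectors of which the near vector of every `p`-fold successor is a multiple, and every
`p`-fold successor has corank `0`, is isolated with `μ = 1` and has no `p`-fold point after it; (b) if `h₂(c) = 3` then every `p`-fold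
successor is NON-isolated, and every non-zero kernel vector `w` of the polar matrix, read in the chart of a non-zero coordinate
`w_j`, gives a `p`-fold, non-isolated successor. Instance `p = 2` PROVED for every `n` by
`CampaignW46.HypersurfacesCharTwo.hypersurface_spine_end` (p548115, from p517564 / p543928 / p513980 / p530584); other `p` not
claimed. [cite: CasasAlvero2000, §3] -/
def CampaignW46HypersurfacesSpineEnd (p n : ℕ) : Prop :=
  ∀ (κ : Type) [Field κ] [CharP κ p] (c : (Fin n → ℕ) → κ),
    WildCones.MultP p n κ c → WildCones.Isol p n κ c → CampaignW46.milnorEmbDim p n κ c = 2 →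
      (CampaignW46.milnorHilbertTwo p n κ c = 1 →
        WildCones.mu p n κ c = 4 ∧
        (∃ S : Finset (Fin n → κ), S.card ≤ 3 ∧
          ∀ (j : Fin n) (τ : Fin n → κ), WildCones.MultP p n κ (WildCones.step p n κ j τ c) →
            ∃ w ∈ S, ∃ r : κ, Function.update τ j 1 = r • w) ∧
        ∀ (j : Fin n) (τ : Fin n → κ), WildCones.MultP p n κ (WildCones.step p n κ j τ c) →
          CampaignW46.milnorEmbDim p n κ (WildCones.step p n κ j τ c) = 0 ∧ WildCones.Isol p n κ (WildCones.step p n κ j τ c) ∧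
            WildCones.mu p n κ (WildCones.step p n κ j τ c) = 1 ∧
              ∀ (j' : Fin n) (τ' : Fin n → κ),
                ¬ WildCones.MultP p n κ (WildCones.step p n κ j' τ' (WildCones.step p n κ j τ c))) ∧
      (CampaignW46.milnorHilbertTwo p n κ c = 3 →
        (∀ (j : Fin n) (τ : Fin n → κ), WildCones.MultP p n κ (WildCones.step p n κ j τ c) →
          ¬ WildCones.Isol p n κ (WildCones.step p n κ j τ c)) ∧
        ∀ (w : Fin n → κ) (j : Fin n),
          Matrix.vecMul w (Matrix.of fun s t : Fin n => if s = t then (0 : κ)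
            else MvPowerSeries.coeff (Finsupp.single s 1 + Finsupp.single t 1) (WildCones.ser p n κ c)) = 0 → w j ≠ 0 →
            WildCones.MultP p n κ (WildCones.step p n κ j ((w j)⁻¹ • w) c) ∧
              ¬ WildCones.Isol p n κ (WildCones.step p n κ j ((w j)⁻¹ • w) c))

/-- [OURS · L1 W4.6 rung (ii), every dimension, PERFECT field; census rev 2] replaces the role of the DESCRIPTION of the whole
sequence of centres (Th. 16.6 p.84 L4–L6 iterated) above an isolated corank-two hypersurface `p`-fold point of the multiple-tangent
class — THE CATERPILLAR; NOT a statement of the manuscript. For every perfect field `κ` of characteristic `p` and every isolated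
`p`-fold state `c` of `z^p = a(u₁,…,uₙ)` with `e(c) = 2`, `h₂(c) = 2`: there are words `i`, `t` and `k ≥ 1`, `k + 4 ≤ μ(c)`, such that
along `c_m = run c i t m`: for `m < k`, every `p`-fold successor of `c_m` either has corank `2` and near vector proportional to the
spine's `(t m with i m ↦ 1)` (it is the next node) or has corank `0`, `μ = 1` and no `p`-fold point after it (a free leaf); and the end
node `c_k` EITHER has `h₂ = 1`, `μ = 4` and only free-leaf `p`-fold successors, OR has `h₂ = 3` and only NON-isolated `p`-fold
successors. Instance `p = 2` PROVED for every `n` by `CampaignW46.HypersurfacesCharTwo.hypersurface_caterpillar` (p548115); other `p`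
not claimed. [cite: CasasAlvero2000, §3] -/
def CampaignW46HypersurfacesCaterpillar (p n : ℕ) : Prop :=
  ∀ (κ : Type) [Field κ] [CharP κ p] [PerfectField κ] (c : (Fin n → ℕ) → κ),
    WildCones.MultP p n κ c → WildCones.Isol p n κ c → CampaignW46.milnorEmbDim p n κ c = 2 →
      CampaignW46.milnorHilbertTwo p n κ c = 2 →
        ∃ (i : ℕ → Fin n) (t : ℕ → Fin n → κ) (k : ℕ), 1 ≤ k ∧ k + 4 ≤ WildCones.mu p n κ c ∧
          (∀ m < k, ∀ (j : Fin n) (τ : Fin n → κ),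
            WildCones.MultP p n κ (WildCones.step p n κ j τ (WildCones.run p n κ c i t m)) →
              (CampaignW46.milnorEmbDim p n κ (WildCones.step p n κ j τ (WildCones.run p n κ c i t m)) = 2 ∧
                  ∃ r : κ, Function.update τ j 1 = r • Function.update (t m) (i m) 1) ∨
                (CampaignW46.milnorEmbDim p n κ (WildCones.step p n κ j τ (WildCones.run p n κ c i t m)) = 0 ∧
                  WildCones.mu p n κ (WildCones.step p n κ j τ (WildCones.run p n κ c i t m)) = 1 ∧
                    ∀ (j' : Fin n) (τ' : Fin n → κ), ¬ WildCones.MultP p n κ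
                      (WildCones.step p n κ j' τ' (WildCones.step p n κ j τ (WildCones.run p n κ c i t m))))) ∧
          ((CampaignW46.milnorHilbertTwo p n κ (WildCones.run p n κ c i t k) = 1 ∧
              WildCones.mu p n κ (WildCones.run p n κ c i t k) = 4 ∧
                ∀ (j : Fin n) (τ : Fin n → κ), WildCones.MultP p n κ (WildCones.step p n κ j τ (WildCones.run p n κ c i t k)) →
                  CampaignW46.milnorEmbDim p n κ (WildCones.step p n κ j τ (WildCones.run p n κ c i t k)) = 0 ∧
                    WildCones.mu p n κ (WildCones.step p n κ j τ (WildCones.run p n κ c i t k)) = 1 ∧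
                      ∀ (j' : Fin n) (τ' : Fin n → κ), ¬ WildCones.MultP p n κ
                        (WildCones.step p n κ j' τ' (WildCones.step p n κ j τ (WildCones.run p n κ c i t k)))) ∨
            (CampaignW46.milnorHilbertTwo p n κ (WildCones.run p n κ c i t k) = 3 ∧
              ∀ (j : Fin n) (τ : Fin n → κ), WildCones.MultP p n κ (WildCones.step p n κ j τ (WildCones.run p n κ c i t k)) →
                ¬ WildCones.Isol p n κ (WildCones.step p n κ j τ (WildCones.run p n κ c i t k))))

/-- [OURS · L1 W4.6 rung (ii), every dimension; census rev 2] replaces the role of NOTHING printed (which corank-two `p`-fold points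
of OUR dynamics have a free infinitely-near point besides the satellite); NOT a statement of the manuscript. THE CUBE CRITERION: for
every field `κ` of characteristic `p`, every isolated `p`-fold state `c` of `z^p = a(u₁,…,uₙ)` with `e(c) = 2`, `h₂(c) = 2`, and every
NON-ZERO kernel vector `w₀` of the polar matrix at which all kernel polars of the tangent cubic vanish (the satellite direction):
a `p`-fold successor of corank `0` (a FREE near point) EXISTS if and only if some polar of `w₀` is non-zero on the kernel (`w₀` is
not a null polar: the kernel cubic is `ℓ₁²ℓ₂` with `ℓ₂ ∤ ℓ₁`, not a cube). Instance `p = 2` PROVED for every `n` by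
`CampaignW46.HypersurfacesCharTwo.hypersurface_exists_free_iff_satellite_not_null` (the CubeCriterion file: the tangent cubic
along the satellite is `x²·polar(w₀,v) + x³·a₃(v)`); other `p` not claimed. [cite: CasasAlvero2000, §3] -/
def CampaignW46HypersurfacesCubeCriterion (p n : ℕ) : Prop :=
  ∀ (κ : Type) [Field κ] [CharP κ p] (c : (Fin n → ℕ) → κ) (w₀ : Fin n → κ),
    WildCones.MultP p n κ c → WildCones.Isol p n κ c → CampaignW46.milnorEmbDim p n κ c = 2 →
      CampaignW46.milnorHilbertTwo p n κ c = 2 → w₀ ≠ 0 →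
      Matrix.vecMul w₀ (Matrix.of fun s t : Fin n => if s = t then (0 : κ)
            else MvPowerSeries.coeff (Finsupp.single s 1 + Finsupp.single t 1) (WildCones.ser p n κ c)) = 0 →
        (∀ lam : Fin n → κ,
          Matrix.vecMul lam (Matrix.of fun s t : Fin n => if s = t then (0 : κ)
            else MvPowerSeries.coeff (Finsupp.single s 1 + Finsupp.single t 1) (WildCones.ser p n κ c)) = 0 →
            ∑ s, lam s * CampaignW46.degForm 2
              (Literature.AlgebraicGeometry.Resolution.MvPowerSeries.pderiv s (WildCones.ser p n κ c)) w₀ = 0) →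
          ((∃ (i : Fin n) (τ : Fin n → κ), WildCones.MultP p n κ (WildCones.step p n κ i τ c) ∧
              CampaignW46.milnorEmbDim p n κ (WildCones.step p n κ i τ c) = 0) ↔
            ∃ v : Fin n → κ,
              Matrix.vecMul v (Matrix.of fun s t : Fin n => if s = t then (0 : κ)
            else MvPowerSeries.coeff (Finsupp.single s 1 + Finsupp.single t 1) (WildCones.ser p n κ c)) = 0 ∧
                ∑ s, w₀ s * CampaignW46.degForm 2
                  (Literature.AlgebraicGeometry.Resolution.MvPowerSeries.pderiv s (WildCones.ser p n κ c)) v ≠ 0)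

/-- [OURS · L1 W4.6 rung (ii), every dimension, PERFECT field; census rev 2] replaces the role of the DESCRIPTION of the next centres
(Th. 16.6 p.84 L5–L6, `D′ = ∇′ ∩ π⁻¹(D)`) for the multiple-tangent class, EXACTLY; NOT a statement of the manuscript. For every perfect
field `κ` of characteristic `p` and every isolated `p`-fold state `c` of `z^p = a(u₁,…,uₙ)` with `e(c) = 2`, `h₂(c) = 2`: there is a
non-zero kernel vector `w₀` at which all kernel polars vanish (the satellite), and EITHER some polar of `w₀` is non-zero on the kernel
and there exist BOTH a `p`-fold successor of corank `2` AND one of corank `0` (with rev 1's bounds: exactly two near `p`-fold points,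
the satellite and a free point), OR all polars of `w₀` vanish on the kernel and EVERY `p`-fold successor has near vector a multiple of
`w₀` and corank `2` (exactly one near `p`-fold point). Instance `p = 2` PROVED for every `n` by
`CampaignW46.HypersurfacesCharTwo.hypersurface_near_count_exact_of_milnorHilbertTwo_eq_two` (the CubeCriterion file, with p538084);
other `p` not claimed. [cite: CasasAlvero2000, §3] -/
def CampaignW46HypersurfacesHilbertTwoExactCount (p n : ℕ) : Prop :=
  ∀ (κ : Type) [Field κ] [CharP κ p] [PerfectField κ] (c : (Fin n → ℕ) → κ),
    WildCones.MultP p n κ c → WildCones.Isol p n κ c → CampaignW46.milnorEmbDim p n κ c = 2 →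
      CampaignW46.milnorHilbertTwo p n κ c = 2 →
        ∃ w₀ : Fin n → κ, w₀ ≠ 0 ∧
          Matrix.vecMul w₀ (Matrix.of fun s t : Fin n => if s = t then (0 : κ)
            else MvPowerSeries.coeff (Finsupp.single s 1 + Finsupp.single t 1) (WildCones.ser p n κ c)) = 0 ∧
          (∀ lam : Fin n → κ,
            Matrix.vecMul lam (Matrix.of fun s t : Fin n => if s = t then (0 : κ)
            else MvPowerSeries.coeff (Finsupp.single s 1 + Finsupp.single t 1) (WildCones.ser p n κ c)) = 0 →
              ∑ s, lam s * CampaignW46.degForm 2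
                (Literature.AlgebraicGeometry.Resolution.MvPowerSeries.pderiv s (WildCones.ser p n κ c)) w₀ = 0) ∧
          (((∃ v : Fin n → κ,
                Matrix.vecMul v (Matrix.of fun s t : Fin n => if s = t then (0 : κ)
            else MvPowerSeries.coeff (Finsupp.single s 1 + Finsupp.single t 1) (WildCones.ser p n κ c)) = 0 ∧
                  ∑ s, w₀ s * CampaignW46.degForm 2
                    (Literature.AlgebraicGeometry.Resolution.MvPowerSeries.pderiv s (WildCones.ser p n κ c)) v ≠ 0) ∧
              (∃ (i : Fin n) (τ : Fin n → κ), WildCones.MultP p n κ (WildCones.step p n κ i τ c) ∧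
                CampaignW46.milnorEmbDim p n κ (WildCones.step p n κ i τ c) = 2) ∧
              ∃ (i : Fin n) (τ : Fin n → κ), WildCones.MultP p n κ (WildCones.step p n κ i τ c) ∧
                CampaignW46.milnorEmbDim p n κ (WildCones.step p n κ i τ c) = 0) ∨
            ((∀ v : Fin n → κ,
                Matrix.vecMul v (Matrix.of fun s t : Fin n => if s = t then (0 : κ)
            else MvPowerSeries.coeff (Finsupp.single s 1 + Finsupp.single t 1) (WildCones.ser p n κ c)) = 0 →
                  ∑ s, w₀ s * CampaignW46.degForm 2
                    (Literature.AlgebraicGeometry.Resolution.MvPowerSeries.pderiv s (WildCones.ser p n κ c)) v = 0) ∧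
              ∀ (i : Fin n) (τ : Fin n → κ), WildCones.MultP p n κ (WildCones.step p n κ i τ c) →
                (∃ r : κ, Function.update τ i 1 = r • w₀) ∧
                  CampaignW46.milnorEmbDim p n κ (WildCones.step p n κ i τ c) = 2))

/-- [OURS · L1 W4.6 rung (ii), EVERY dimension, EVERY corank, EVERY field; census rev 3] replaces the role of the ALTERNATIVE
«finitely many next centres, each of the same kind with a smaller invariant» / «the procedure changes regime» (Th. 16.6 p.84 L4–L6
with §16.3 p.87) for isolated hypersurface `p`-fold points of route WildCones' dynamics; NOT a statement of the manuscript. THE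
NEAR-POINT DICHOTOMY: for every field `κ` of characteristic `p` and every ISOLATED `p`-fold state `c` of `z^p = a(u₁,…,uₙ)`: EITHER
there is a set `S` of AT MOST THREE vectors of which the near vector of every `p`-fold successor is a multiple AND every `p`-fold
successor is isolated with strictly smaller Milnor number, OR every `p`-fold successor is NON-isolated and (`e(c) ≥ 3` or
`e(c) = 2 ∧ h₂(c) = 3`). Instance `p = 2` PROVED for every `n` by `CampaignW46.HypersurfacesCharTwo.hypersurface_near_dichotomy`
(the NearDichotomy file, from gens 3–6: p501990, p514670, p513980, p543928); other `p` not claimed. [cite: CasasAlvero2000, §3] -/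
def CampaignW46HypersurfacesNearDichotomy (p n : ℕ) : Prop :=
  ∀ (κ : Type) [Field κ] [CharP κ p] (c : (Fin n → ℕ) → κ),
    WildCones.MultP p n κ c → WildCones.Isol p n κ c →
      ((∃ S : Finset (Fin n → κ), S.card ≤ 3 ∧
          ∀ (i : Fin n) (τ : Fin n → κ), WildCones.MultP p n κ (WildCones.step p n κ i τ c) →
            ∃ w ∈ S, ∃ r : κ, Function.update τ i 1 = r • w) ∧
        ∀ (i : Fin n) (τ : Fin n → κ), WildCones.MultP p n κ (WildCones.step p n κ i τ c) →
          WildCones.Isol p n κ (WildCones.step p n κ i τ c) ∧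
            WildCones.mu p n κ (WildCones.step p n κ i τ c) < WildCones.mu p n κ c) ∨
      ((∀ (i : Fin n) (τ : Fin n → κ), WildCones.MultP p n κ (WildCones.step p n κ i τ c) →
          ¬ WildCones.Isol p n κ (WildCones.step p n κ i τ c)) ∧
        (3 ≤ CampaignW46.milnorEmbDim p n κ c ∨
          (CampaignW46.milnorEmbDim p n κ c = 2 ∧ CampaignW46.milnorHilbertTwo p n κ c = 3)))

/-- [OURS · L1 W4.6 rung (ii), `n = 4`, EVERY field; census rev 3] replaces the role of the DESCRIPTION AND FATE of the next centres
(Th. 16.6 p.84 L4–L6) for ORDER-`p`-CLEANED isolated `p`-fold points of fourfold hypersurfaces `z^p = a(u₀,u₁,u₂,u₃)` — the slot's target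
class «order-2 cleaned, n ≥ 3» in dimension four (dimension three is the corank-one regime of p506168); NOT a statement of the manuscript.
For every field `κ` of characteristic `p` and every isolated `p`-fold state `c` (`n = 4`) with a cleaned monomial of degree `p` (`OrdP`):
EITHER `e(c) = 0` and NO `p`-fold successor exists; OR `e(c) = 2`, `h₂(c) ≤ 2`, there is a set `S` of near-vector representatives with
(`S.card ≤ 3 ∧ h₂ = 1`) or (`S.card ≤ 2 ∧ h₂ = 2`), and every `p`-fold successor is isolated with smaller `μ`; OR `e(c) = 2`, `h₂(c) = 3`
and every `p`-fold successor is NON-isolated. Instance `p = 2` PROVED by `CampaignW46.HypersurfacesCharTwo.fourfold_ordTwo_near_census`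
(the NearDichotomy file); other `p` not claimed. [cite: GreuelPfister2026, Thm 3.5 and Cor 3.7] -/
def CampaignW46FourfoldsOrdTwoCensus (p : ℕ) : Prop :=
  ∀ (κ : Type) [Field κ] [CharP κ p] (c : (Fin 4 → ℕ) → κ),
    WildCones.MultP p 4 κ c → WildCones.Isol p 4 κ c → WildCones.OrdP p 4 κ c →
      (CampaignW46.milnorEmbDim p 4 κ c = 0 ∧
          ∀ (i : Fin 4) (τ : Fin 4 → κ), ¬ WildCones.MultP p 4 κ (WildCones.step p 4 κ i τ c)) ∨
        (CampaignW46.milnorEmbDim p 4 κ c = 2 ∧ CampaignW46.milnorHilbertTwo p 4 κ c ≤ 2 ∧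
          (∃ S : Finset (Fin 4 → κ),
            (S.card ≤ 3 ∧ CampaignW46.milnorHilbertTwo p 4 κ c = 1 ∨ S.card ≤ 2 ∧ CampaignW46.milnorHilbertTwo p 4 κ c = 2) ∧
              ∀ (i : Fin 4) (τ : Fin 4 → κ), WildCones.MultP p 4 κ (WildCones.step p 4 κ i τ c) →
                ∃ w ∈ S, ∃ r : κ, Function.update τ i 1 = r • w) ∧
          ∀ (i : Fin 4) (τ : Fin 4 → κ), WildCones.MultP p 4 κ (WildCones.step p 4 κ i τ c) →
            WildCones.Isol p 4 κ (WildCones.step p 4 κ i τ c) ∧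
              WildCones.mu p 4 κ (WildCones.step p 4 κ i τ c) < WildCones.mu p 4 κ c) ∨
        (CampaignW46.milnorEmbDim p 4 κ c = 2 ∧ CampaignW46.milnorHilbertTwo p 4 κ c = 3 ∧
          ∀ (i : Fin 4) (τ : Fin 4 → κ), WildCones.MultP p 4 κ (WildCones.step p 4 κ i τ c) →
            ¬ WildCones.Isol p 4 κ (WildCones.step p 4 κ i τ c))

/-- [OURS · L1 W4.6 rung (ii), every dimension, EVERY field; census rev 4] replaces the role of NOTHING printed (the configuration of
the free infinitely-near points of OUR corank-two `p`-fold points: `0`, `1` or `3`, never `2`); NOT a statement of the manuscript.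
TWO FREE POINTS GIVE A THIRD: for every field `κ` of characteristic `p`, every isolated `p`-fold state `c` of `z^p = a(u₁,…,uₙ)` with
`e(c) = 2`, and charts/translations `(i₁, τ₁)`, `(i₂, τ₂)` whose successors are `p`-fold points of corank `0` with NON-proportional near
vectors: there is `(i₃, τ₃)` whose successor is a `p`-fold point of corank `0` and whose near vector is proportional to NEITHER of the two.
Instance `p = 2` PROVED for every `n` by `CampaignW46.HypersurfacesCharTwo.hypersurface_third_free_successor` (p555329: with the mixed
polars `m₁, m₂ ≠ 0`, the vector `m₂w₁ + m₁w₂` is the third root of the kernel cubic, free); other `p` not claimed.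
[cite: CasasAlvero2000, §3] -/
def CampaignW46HypersurfacesThirdFreePoint (p n : ℕ) : Prop :=
  ∀ (κ : Type) [Field κ] [CharP κ p] (c : (Fin n → ℕ) → κ) (i₁ i₂ : Fin n) (τ₁ τ₂ : Fin n → κ),
    WildCones.MultP p n κ c → WildCones.Isol p n κ c → CampaignW46.milnorEmbDim p n κ c = 2 →
      WildCones.MultP p n κ (WildCones.step p n κ i₁ τ₁ c) → WildCones.MultP p n κ (WildCones.step p n κ i₂ τ₂ c) →
        CampaignW46.milnorEmbDim p n κ (WildCones.step p n κ i₁ τ₁ c) = 0 →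
          CampaignW46.milnorEmbDim p n κ (WildCones.step p n κ i₂ τ₂ c) = 0 →
            (∀ r : κ, Function.update τ₂ i₂ 1 ≠ r • Function.update τ₁ i₁ 1) →
              ∃ (i₃ : Fin n) (τ₃ : Fin n → κ), WildCones.MultP p n κ (WildCones.step p n κ i₃ τ₃ c) ∧
                CampaignW46.milnorEmbDim p n κ (WildCones.step p n κ i₃ τ₃ c) = 0 ∧
                  (∀ r : κ, Function.update τ₃ i₃ 1 ≠ r • Function.update τ₁ i₁ 1) ∧
                    ∀ r : κ, Function.update τ₃ i₃ 1 ≠ r • Function.update τ₂ i₂ 1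

/-- [OURS · L1 W4.6 rung (ii), every dimension, ALGEBRAICALLY CLOSED field; census rev 5] replaces the role of the DESCRIPTION of the next
centres (Th. 16.6 p.84 L5–L6) for the three-tangents class of isolated corank-two hypersurface `p`-fold points over an algebraically
closed field, EXACTLY; NOT a statement of the manuscript. For every algebraically closed field `κ` of characteristic `p` and every
isolated `p`-fold state `c` of `z^p = a(u₁,…,uₙ)` with `e(c) = 2`, `h₂(c) = 1`: there are three charts/translations `(i₁,τ₁)`, `(i₂,τ₂)`,
`(i₃,τ₃)` whose successors are `p`-fold points of corank `0` and whose near vectors are pairwise non-proportional (with rev 1's bound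
`≤ 3`: exactly three infinitely-near `p`-fold points, all free). Instance `p = 2` PROVED for every `n` by
`CampaignW46.HypersurfacesCharTwo.hypersurface_three_near_points_of_isAlgClosed` (the ThreeTangentsClosed file); other `p` not
claimed. [cite: CasasAlvero2000, §3] -/
def CampaignW46HypersurfacesThreeTangentsClosed (p n : ℕ) : Prop :=
  ∀ (κ : Type) [Field κ] [CharP κ p] [IsAlgClosed κ] (c : (Fin n → ℕ) → κ),
    WildCones.MultP p n κ c → WildCones.Isol p n κ c → CampaignW46.milnorEmbDim p n κ c = 2 →
      CampaignW46.milnorHilbertTwo p n κ c = 1 →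
        ∃ (i₁ i₂ i₃ : Fin n) (τ₁ τ₂ τ₃ : Fin n → κ),
          (WildCones.MultP p n κ (WildCones.step p n κ i₁ τ₁ c) ∧ CampaignW46.milnorEmbDim p n κ (WildCones.step p n κ i₁ τ₁ c) = 0) ∧
          (WildCones.MultP p n κ (WildCones.step p n κ i₂ τ₂ c) ∧ CampaignW46.milnorEmbDim p n κ (WildCones.step p n κ i₂ τ₂ c) = 0) ∧
          (WildCones.MultP p n κ (WildCones.step p n κ i₃ τ₃ c) ∧ CampaignW46.milnorEmbDim p n κ (WildCones.step p n κ i₃ τ₃ c) = 0) ∧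
          (∀ r : κ, Function.update τ₂ i₂ 1 ≠ r • Function.update τ₁ i₁ 1) ∧
          (∀ r : κ, Function.update τ₃ i₃ 1 ≠ r • Function.update τ₁ i₁ 1) ∧
          (∀ r : κ, Function.update τ₃ i₃ 1 ≠ r • Function.update τ₂ i₂ 1)

end Summit.ResolutionOfSingularities.ResolutionOfSingularities.Theorems

end
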